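import Literature.AlgebraicGeometry.AbelianSchemes.TupleRelFacObjIsoGlue   -- ★ (mine) structure-free `facObjIso` clauses (X, X̂, Poincaré), level reading; re-exports `TupleRelFacObjIso`
import HarnessLib

/-!
# One MOVE of a generic PEL tuple to a finer relative stage: the six clauses along `𝟙` via `(facObjIso⁻¹, facObjIso⁻¹)`

Road (S♭) of `stub_GSPREAD` ([MumfordFogartyKirwan1994] Ch. 7 §2 «spreading a point of the moduli functor», [EGAIV3] 8.8.2): the generic
PEL tuple over `P ⊗ Spec K` is carried along the finer and finer stages `… → P ⊗ D(s) → P ⊗ D(t)` produced by the spread organs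
(polarisation, endomorphisms, level).  ONE MOVE, in the ★ `OverFac.facObjIso` vocabulary (`ℓ : G ⟶ T` over `X`; for the stages
`ℓ = relLeg σ`, `G = genOver t`, `T = stageOver σ`): given structures `(act, λ, φ)` on the generic base change `𝒜 ×_X G` (dual pair
`D ×_X G`) and structures `(act′, λ′, φ′)` on the iterated base change `(𝒜 ×_X T) ×_T G` (dual pair `(D ×_X T) ×_T G`) that MATCH through
`e = facObjIso ℓ 𝒜.X` and `ê = facObjIso ℓ Â.X` (`φ′ᵢ ≫ e = φᵢ`, `λ′ ≫ ê = e ≫ λ`, `act′ a ≫ e = e ≫ act a`), the pair `(e⁻¹, ê⁻¹)`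
satisfies ALL SIX CLAUSES along `𝟙 G` from `(𝒜 ×_X G, act, D ×_X G, λ, φ)` to `((𝒜 ×_X T) ×_T G, act′, (D ×_X T) ×_T G, λ′, φ′)`
(§1); composed with an incoming six-clause relation along `𝟙 G` (★ `tupleRel_comp_id_id`) this is the inductive step of the spread (§2).
§3: an abelian scheme `A₁` over `G` that is a base change of `𝒜` along `G.hom` is a base change of `𝒜 ×_X T` along `ℓ` (the pull-back
relation RESTRICTED to a finer stage before any structure is transported; ★ `isBaseChangeVia_of_comp`).

## What existed / was missing / was proved
* existed: ★ `baseChange_isBaseChangeVia_id_facObjIso_inv`, ★ `nonempty_pullback_map_facObjIso_inv_P_iso`, ★ `levelStructure_isBaseChangeVia_id_of_isMonHom`,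
  ★ `isMonHom_facObjIso_inv`, ★ `tupleRel_comp_id_id`, ★ `IsBaseChangeVia.exists_comp_eq_of_comp` ∕ ★ `isBaseChangeVia_of_comp`.
* missing, proved here (sorry-free): `tupleRel_id_facObjIso_inv_of_compat` (§1), `tupleRel_id_comp_facObjIso_inv_of_compat` (§2),
  `exists_isBaseChangeVia_baseChange_of_over_hom` (§3).
-/

set_option autoImplicit false

noncomputable section

-- Mathlib's `Over`/pull-back API is stated across semireducible wrappers (as in the ★ `AbelianSchemes/*` files).
set_option backward.isDefEq.respectTransparency false

universe u

open CategoryTheory CategoryTheory.Limits AlgebraicGeometry MonoidalCategory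
open Literature.AlgebraicGeometry.Limits.OverFac (facObjIso)

namespace Literature.AlgebraicGeometry.AbelianSchemes

namespace AbelianSchemeOver

variable {X : Scheme.{u}} {T G : Over X} (ℓ : G ⟶ T) (𝒜 : AbelianSchemeOver X) (D : 𝒜.DualPair) {O : Type*} {g n : ℕ}

/-! ### §1 The six clauses of `(facObjIso⁻¹, facObjIso⁻¹)` along `𝟙 G` from matching structures -/

/-- **ONE MOVE TO A FINER STAGE IS AN ISOMORPHISM OF TUPLES.**  For `ℓ : G ⟶ T` over `X`, structures `(act, λ, φ)` on `𝒜 ×_X G` and `(act′, λ′, φ′)`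
on `(𝒜 ×_X T) ×_T G` matching through `e = facObjIso ℓ 𝒜.X`, `ê = facObjIso ℓ Â.X` (`φ′ᵢ ≫ e = φᵢ`, `λ′ ≫ ê = e ≫ λ`, `act′ a ≫ e = e ≫ act a`), the pair
`(e⁻¹, ê⁻¹)` satisfies the six clauses along `𝟙 G`: level ∕ `X` (★ `levelStructure_isBaseChangeVia_id_of_isMonHom`, ★ `isMonHom_facObjIso_inv`), `X̂`
(★ `baseChange_isBaseChangeVia_id_facObjIso_inv` for `Â`), Poincaré (★ `nonempty_pullback_map_facObjIso_inv_P_iso`), `λ` and `𝒪` (the matching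
equations inverted).  [cite: MumfordFogartyKirwan1994, Ch. 7 §2 Definition 7.2 (p. 129) and Definition 7.3 (p. 130)] [cite: GortzWedhorn2020, Section (4.7) (pp. 107–108)]
[cite: Kottwitz1992, §5 (p. 390)] -/
theorem tupleRel_id_facObjIso_inv_of_compat
    (act : O → ((𝒜.baseChange G.hom).X ⟶ (𝒜.baseChange G.hom).X)) (lam : (𝒜.baseChange G.hom).X ⟶ (D.baseChange G.hom).hat.X)
    (φ : (𝒜.baseChange G.hom).LevelStructure g n)
    (act' : O → (((𝒜.baseChange T.hom).baseChange ℓ.left).X ⟶ ((𝒜.baseChange T.hom).baseChange ℓ.left).X))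
    (lam' : ((𝒜.baseChange T.hom).baseChange ℓ.left).X ⟶ ((D.baseChange T.hom).baseChange ℓ.left).hat.X)
    (φ' : ((𝒜.baseChange T.hom).baseChange ℓ.left).LevelStructure g n)
    (hσ : ∀ i, φ'.σ i ≫ (facObjIso ℓ 𝒜.X).hom = φ.σ i)
    (hlam : lam' ≫ (facObjIso ℓ D.hat.X).hom = (facObjIso ℓ 𝒜.X).hom ≫ lam)
    (hact : ∀ a, act' a ≫ (facObjIso ℓ 𝒜.X).hom = (facObjIso ℓ 𝒜.X).hom ≫ act a) :
    φ.IsBaseChangeVia φ' (𝟙 G.left) (facObjIso ℓ 𝒜.X).inv.left ∧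
      (D.baseChange G.hom).hat.IsBaseChangeVia ((D.baseChange T.hom).baseChange ℓ.left).hat (𝟙 G.left) (facObjIso ℓ D.hat.X).inv.left ∧
      (∃ (wG : (𝒜.baseChange G.hom).X.hom ≫ 𝟙 G.left = (facObjIso ℓ 𝒜.X).inv.left ≫ ((𝒜.baseChange T.hom).baseChange ℓ.left).X.hom)
          (wĜ : (D.baseChange G.hom).hat.X.hom ≫ 𝟙 G.left =
            (facObjIso ℓ D.hat.X).inv.left ≫ ((D.baseChange T.hom).baseChange ℓ.left).hat.X.hom),
        Nonempty ((Scheme.Modules.pullback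
          (pullback.map (𝒜.baseChange G.hom).X.hom (D.baseChange G.hom).hat.X.hom ((𝒜.baseChange T.hom).baseChange ℓ.left).X.hom
            ((D.baseChange T.hom).baseChange ℓ.left).hat.X.hom (facObjIso ℓ 𝒜.X).inv.left (facObjIso ℓ D.hat.X).inv.left
            (𝟙 G.left) wG wĜ)).obj ((D.baseChange T.hom).baseChange ℓ.left).P ≅ (D.baseChange G.hom).P)) ∧
      lam.left ≫ (facObjIso ℓ D.hat.X).inv.left = (facObjIso ℓ 𝒜.X).inv.left ≫ lam'.left ∧
      ∀ a : O, (act a).left ≫ (facObjIso ℓ 𝒜.X).inv.left = (facObjIso ℓ 𝒜.X).inv.left ≫ (act' a).left := by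
  haveI : IsMonHom (M := (𝒜.baseChange G.hom).X) (N := ((𝒜.baseChange T.hom).baseChange ℓ.left).X) (facObjIso ℓ 𝒜.X).inv :=
    isMonHom_facObjIso_inv ℓ 𝒜.X
  have hσ' : ∀ i, φ.σ i ≫ (facObjIso ℓ 𝒜.X).inv = φ'.σ i := fun i => by
    rw [← hσ i, Category.assoc, Iso.hom_inv_id, Category.comp_id]
  have wG : (𝒜.baseChange G.hom).X.hom ≫ 𝟙 G.left = (facObjIso ℓ 𝒜.X).inv.left ≫ ((𝒜.baseChange T.hom).baseChange ℓ.left).X.hom := by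
    rw [Category.comp_id]; exact (Over.w (facObjIso ℓ 𝒜.X).inv).symm
  have wĜ : (D.baseChange G.hom).hat.X.hom ≫ 𝟙 G.left =
      (facObjIso ℓ D.hat.X).inv.left ≫ ((D.baseChange T.hom).baseChange ℓ.left).hat.X.hom := by
    rw [Category.comp_id]; exact (Over.w (facObjIso ℓ D.hat.X).inv).symm
  refine ⟨levelStructure_isBaseChangeVia_id_of_isMonHom φ φ' (facObjIso ℓ 𝒜.X).inv hσ',
    baseChange_isBaseChangeVia_id_facObjIso_inv ℓ D.hat, ⟨wG, wĜ, nonempty_pullback_map_facObjIso_inv_P_iso ℓ 𝒜 D wG wĜ⟩, ?_, fun a => ?_⟩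
  · have h : (facObjIso ℓ 𝒜.X).inv ≫ lam' = lam ≫ (facObjIso ℓ D.hat.X).inv := by
      rw [Iso.inv_comp_eq, ← Category.assoc, ← hlam, Category.assoc, Iso.hom_inv_id, Category.comp_id]
    rw [← Over.comp_left, ← Over.comp_left, h]
  · have h : (facObjIso ℓ 𝒜.X).inv ≫ act' a = act a ≫ (facObjIso ℓ 𝒜.X).inv := by
      rw [Iso.inv_comp_eq, ← Category.assoc, ← hact a, Category.assoc, Iso.hom_inv_id, Category.comp_id]
    rw [← Over.comp_left, ← Over.comp_left, h]

/-! ### §2 The inductive step: an incoming relation along `𝟙 G` composed with the move -/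

/-- **THE INDUCTIVE STEP OF THE SPREAD.**  If a tuple `(A₁, act₁, Â₁, 𝒫₁, λ₁, φ₁)` over `G` is related by the six clauses along `𝟙 G` via `(M, M̂)` to
`(𝒜 ×_X G, act, D ×_X G, λ, φ)`, and `(act′, λ′, φ′)` on `(𝒜 ×_X T) ×_T G` match `(act, λ, φ)` through `facObjIso` (§1), then `(A₁, …)` is related along
`𝟙 G` via `(M ≫ e⁻¹, M̂ ≫ ê⁻¹)` to `((𝒜 ×_X T) ×_T G, act′, (D ×_X T) ×_T G, λ′, φ′)` (★ `tupleRel_comp_id_id`).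
[cite: MumfordFogartyKirwan1994, Ch. 7 §2 Definition 7.2 (p. 129)] [cite: GortzWedhorn2020, Section (4.7) (pp. 107–108)] -/
theorem tupleRel_id_comp_facObjIso_inv_of_compat
    {A₁ : AbelianSchemeOver G.left} (act₁ : O → (A₁.X ⟶ A₁.X)) (D₁ : A₁.DualPair) (lam₁ : A₁.X ⟶ D₁.hat.X) (φ₁ : A₁.LevelStructure g n)
    (act : O → ((𝒜.baseChange G.hom).X ⟶ (𝒜.baseChange G.hom).X)) (lam : (𝒜.baseChange G.hom).X ⟶ (D.baseChange G.hom).hat.X)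
    (φ : (𝒜.baseChange G.hom).LevelStructure g n)
    {M : A₁.X.left ⟶ (𝒜.baseChange G.hom).X.left} {Mh : D₁.hat.X.left ⟶ (D.baseChange G.hom).hat.X.left}
    (h : φ₁.IsBaseChangeVia φ (𝟙 G.left) M ∧ D₁.hat.IsBaseChangeVia (D.baseChange G.hom).hat (𝟙 G.left) Mh ∧
      (∃ (wG : A₁.X.hom ≫ 𝟙 G.left = M ≫ (𝒜.baseChange G.hom).X.hom) (wĜ : D₁.hat.X.hom ≫ 𝟙 G.left = Mh ≫ (D.baseChange G.hom).hat.X.hom),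
        Nonempty ((Scheme.Modules.pullback
          (pullback.map A₁.X.hom D₁.hat.X.hom (𝒜.baseChange G.hom).X.hom (D.baseChange G.hom).hat.X.hom M Mh (𝟙 G.left) wG wĜ)).obj
            (D.baseChange G.hom).P ≅ D₁.P)) ∧
      lam₁.left ≫ Mh = M ≫ lam.left ∧ ∀ a : O, (act₁ a).left ≫ M = M ≫ (act a).left)
    (act' : O → (((𝒜.baseChange T.hom).baseChange ℓ.left).X ⟶ ((𝒜.baseChange T.hom).baseChange ℓ.left).X))
    (lam' : ((𝒜.baseChange T.hom).baseChange ℓ.left).X ⟶ ((D.baseChange T.hom).baseChange ℓ.left).hat.X)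
    (φ' : ((𝒜.baseChange T.hom).baseChange ℓ.left).LevelStructure g n)
    (hσ : ∀ i, φ'.σ i ≫ (facObjIso ℓ 𝒜.X).hom = φ.σ i)
    (hlam : lam' ≫ (facObjIso ℓ D.hat.X).hom = (facObjIso ℓ 𝒜.X).hom ≫ lam)
    (hact : ∀ a, act' a ≫ (facObjIso ℓ 𝒜.X).hom = (facObjIso ℓ 𝒜.X).hom ≫ act a) :
    φ₁.IsBaseChangeVia φ' (𝟙 G.left) (M ≫ (facObjIso ℓ 𝒜.X).inv.left) ∧
      D₁.hat.IsBaseChangeVia ((D.baseChange T.hom).baseChange ℓ.left).hat (𝟙 G.left) (Mh ≫ (facObjIso ℓ D.hat.X).inv.left) ∧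
      (∃ (wG : A₁.X.hom ≫ 𝟙 G.left = (M ≫ (facObjIso ℓ 𝒜.X).inv.left) ≫ ((𝒜.baseChange T.hom).baseChange ℓ.left).X.hom)
          (wĜ : D₁.hat.X.hom ≫ 𝟙 G.left = (Mh ≫ (facObjIso ℓ D.hat.X).inv.left) ≫ ((D.baseChange T.hom).baseChange ℓ.left).hat.X.hom),
        Nonempty ((Scheme.Modules.pullback
          (pullback.map A₁.X.hom D₁.hat.X.hom ((𝒜.baseChange T.hom).baseChange ℓ.left).X.hom
            ((D.baseChange T.hom).baseChange ℓ.left).hat.X.hom (M ≫ (facObjIso ℓ 𝒜.X).inv.left) (Mh ≫ (facObjIso ℓ D.hat.X).inv.left)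
            (𝟙 G.left) wG wĜ)).obj ((D.baseChange T.hom).baseChange ℓ.left).P ≅ D₁.P)) ∧
      lam₁.left ≫ (Mh ≫ (facObjIso ℓ D.hat.X).inv.left) = (M ≫ (facObjIso ℓ 𝒜.X).inv.left) ≫ lam'.left ∧
      ∀ a : O, (act₁ a).left ≫ (M ≫ (facObjIso ℓ 𝒜.X).inv.left) = (M ≫ (facObjIso ℓ 𝒜.X).inv.left) ≫ (act' a).left :=
  tupleRel_comp_id_id h (tupleRel_id_facObjIso_inv_of_compat ℓ 𝒜 D act lam φ act' lam' φ' hσ hlam hact)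

/-! ### §3 Restricting a pull-back relation to a finer stage (before any structure is transported) -/

/-- **A BASE CHANGE OF `𝒜` ALONG `G → X` IS A BASE CHANGE OF `𝒜 ×_X T` ALONG `ℓ : G → T`** (`G.hom = ℓ ≫ T.hom`): the comparison map `m` over
`M` (`m ≫ pr = M`) is cartesian (★ `IsBaseChangeVia.exists_comp_eq_of_comp`, ★ `isBaseChangeVia_of_comp`).  On road (S♭) this moves the spread family to a
finer stage where `2` and `N` are units, before the E′-structures are transported. [cite: GortzWedhorn2020, Prop. 4.16 (p. 101) and Section (4.7) (pp. 107–108)]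
[cite: MumfordFogartyKirwan1994, Ch. 7 §2 Definition 7.2 (p. 129)] -/
theorem exists_isBaseChangeVia_baseChange_of_over_hom {A₁ : AbelianSchemeOver G.left} {M : A₁.X.left ⟶ 𝒜.X.left}
    (h : A₁.IsBaseChangeVia 𝒜 G.hom M) :
    ∃ m : A₁.X.left ⟶ (𝒜.baseChange T.hom).X.left, A₁.IsBaseChangeVia (𝒜.baseChange T.hom) ℓ.left m ∧ m ≫ pullback.fst 𝒜.X.hom T.hom = M := by
  have h₁ : A₁.IsBaseChangeVia 𝒜 (ℓ.left ≫ T.hom) M := by rw [Over.w ℓ]; exact h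
  have h₂ : (𝒜.baseChange T.hom).IsBaseChangeVia 𝒜 T.hom (pullback.fst 𝒜.X.hom T.hom) := 𝒜.baseChange_isBaseChangeVia T.hom
  obtain ⟨m, hmG, hmπ⟩ := IsBaseChangeVia.exists_comp_eq_of_comp h₁ h₂
  exact ⟨m, isBaseChangeVia_of_comp h₁ h₂ m hmG hmπ, hmG⟩

end AbelianSchemeOver

end Literature.AlgebraicGeometry.AbelianSchemes
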